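import Summits.CriticalPhenomena.SAWScalingLimit.Theses.SAWTensorRG
import Summits.CriticalPhenomena.SAWScalingLimit.Theses.SAWRestrictionRigidity
import HarnessLib

/-!
# Structure of the crux `ConformalAvoidance` (route `SAWTensorRG`, item stmt-CriticalPhenomena-7605):
# it is exactly existence ∧ conformal invariance of the avoidance limits, and its existence half is
# the sibling crux `AvoidanceCocycleLimit` (route `SAWRestrictionRigidity`, item stmt-CriticalPhenomena-1369)

`SAWTensorRG.ConformalAvoidance`: for hull-subdomain pairs `D ⊇ D'`, `E ⊇ E'` of Dobrushin domains
(same marked points, agreeing in balls around them), endpoint approximations `(a_δ, b_δ)` of `D` and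
`(c_δ, d_δ)` of `E`, and a conformal `g : D → E` with boundary values `a ↦ E.pt 0`, `b ↦ E.pt 1`,
`g(D') = E'`, there is ONE `r ∈ [0, ∞]` with `P_δ^D(range γ ⊆ cl D') → r` and `P_δ^E(range γ ⊆ cl E') → r`
along the full filter `δ → 0+`.

PROVED here (no `sorry`, no unproved named fact):

* `avoidanceCocycleLimit_of_conformalAvoidance` — at `E = D`, `E' = D'`, `g = refl` the crux IS the
  existence of the full-filter avoidance limit for every hull pair and endpoint approximation, i.e. the
  sibling crux `SAWRestrictionRigidity.AvoidanceCocycleLimit` (stmt-CriticalPhenomena-1369); so 7605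
  cannot close before 1369 does;
* `stub_avoidanceLimitExists_iff_avoidanceCocycleLimit` — the registered stub `stub_avoidanceLimitExists`
  of line `birth` is that sibling crux VERBATIM (`Iff.rfl`);
* `conformallyInvariantLimits_of_conformalAvoidance` — the crux gives the value-free conformal
  INVARIANCE of the limits (any two limits `r₁`, `r₂` of the two families coincide: both families tend
  to the common `r`, and limits along the proper filter `𝓝[>] 0` are unique);
* `conformalAvoidance_of_exists_of_invariant` and `conformalAvoidance_iff` — conversely existence +
  invariance give the crux, so `ConformalAvoidance ↔ AvoidanceLimitExists ∧ ConformallyInvariantLimits`: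
  the birth skeleton's top-level split is lossless.

With `SAWTensorRGConformalAvoidanceOfAvoidanceLimit.lean` (`AvoidanceLimit (10649) ⇒ ConformalAvoidance`)
this gives the kernel-checked lattice of open cruxes `10649 ⇒ 7605 ⇒ 1369`.
All statements [folklore]; context: Lawler–Schramm–Werner, *On the scaling limit of planar
self-avoiding walk* (2004), §3.4.2 and §4.1.
-/

noncomputable section

open scoped Topology ENNReal NNReal
open Filter Set MeasureTheory
open Literature.Probability.RandomPlanarGeometry Literature.Probability.LatticeModels
open Summit.CriticalPhenomena.SAWScalingLimit.Theses.SAWTensorRG (ConformalAvoidance)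
open Summit.CriticalPhenomena.SAWScalingLimit.Theses.SAWRestrictionRigidity (AvoidanceCocycleLimit)

namespace Summit.CriticalPhenomena.SAWScalingLimit.Theorems.ConformalAvoidance

/-! ### The identity of a Dobrushin domain as crux datum -/

/-- The identity conformal equivalence of `D` has boundary value `p` at every point `p`. [folklore] -/
theorem hasBoundaryValue_refl (U : Set ℂ) (p : ℂ) : (ConformalEquiv.refl U).HasBoundaryValue p p := by
  show Tendsto (fun z => ConformalEquiv.refl U z) (𝓝[U] p) (𝓝 p)
  simp only [ConformalEquiv.refl_apply]
  exact tendsto_id.mono_left nhdsWithin_le_nhds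

/-- The identity conformal equivalence maps every set to itself. [folklore] -/
theorem image_refl (U S : Set ℂ) : (ConformalEquiv.refl U) '' S = S := by
  ext z
  simp only [mem_image, ConformalEquiv.refl_apply, exists_eq_right]

/-! ### The existence half of the crux is the sibling crux `AvoidanceCocycleLimit` -/

/-- **`ConformalAvoidance ⇒ AvoidanceCocycleLimit`** (crux stmt-CriticalPhenomena-7605 of route
`SAWTensorRG` implies crux stmt-CriticalPhenomena-1369 of route `SAWRestrictionRigidity`): specialise the
crux to `E = D`, `E' = D'`, `(c, d) = (a, b)` and `g = ConformalEquiv.refl D` (boundary values and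
`g(D') = D'` are trivial) and keep the first convergence. [folklore] -/
theorem avoidanceCocycleLimit_of_conformalAvoidance : ConformalAvoidance → AvoidanceCocycleLimit := by
  intro h D D' a b hab hsub h0 h1 hball
  obtain ⟨r, hr, -⟩ := h D D' D D' a b a b (ConformalEquiv.refl D.carrier) hab hab hsub h0 h1 hball
    hsub h0 h1 hball (hasBoundaryValue_refl _ _) (hasBoundaryValue_refl _ _) (image_refl _ _)
  exact ⟨r, hr⟩

/-- The registered stub `stub_avoidanceLimitExists` of line `birth` (statement `AvoidanceLimitExists` of
the skeleton, literal) IS the sibling crux `SAWRestrictionRigidity.AvoidanceCocycleLimit`, by term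
identity. [folklore] -/
theorem stub_avoidanceLimitExists_iff_avoidanceCocycleLimit :
    (∀ (D D' : DobrushinDomain) (a b : ℝ → Site 2), SAW.IsEndpointApprox D a b →
      D'.carrier ⊆ D.carrier → D'.pt 0 = D.pt 0 → D'.pt 1 = D.pt 1 →
      (∃ ε : ℝ, 0 < ε ∧ D'.carrier ∩ Metric.ball (D.pt 0) ε = D.carrier ∩ Metric.ball (D.pt 0) ε ∧
        D'.carrier ∩ Metric.ball (D.pt 1) ε = D.carrier ∩ Metric.ball (D.pt 1) ε) →
      ∃ r : ENNReal,
        Tendsto (fun δ => ((SAW.law D.carrier δ (a δ) (b δ)).map (fun γ => γ.curve))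
            (CurveClass.rangeSubset (closure D'.carrier))) (𝓝[>] 0) (𝓝 r)) ↔
    AvoidanceCocycleLimit :=
  Iff.rfl

/-! ### The invariance half -/

/-- **`ConformalAvoidance ⇒` conformal invariance of the limit values** (the statement
`ConformallyInvariantLimits` of the birth skeleton, literal): for crux data and any limits `r₁` of the
`D`-family and `r₂` of the `E`-family, `r₁ = r₂` — both families tend to the common `r` of the crux and
limits along the proper filter `𝓝[>] 0` in the Hausdorff space `ℝ≥0∞` are unique. [folklore] -/
theorem conformallyInvariantLimits_of_conformalAvoidance (h : ConformalAvoidance) :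
    ∀ (D D' E E' : DobrushinDomain) (a b c d : ℝ → Site 2) (g : ConformalEquiv D.carrier E.carrier),
      SAW.IsEndpointApprox D a b → SAW.IsEndpointApprox E c d →
      D'.carrier ⊆ D.carrier → D'.pt 0 = D.pt 0 → D'.pt 1 = D.pt 1 →
      (∃ ε : ℝ, 0 < ε ∧ D'.carrier ∩ Metric.ball (D.pt 0) ε = D.carrier ∩ Metric.ball (D.pt 0) ε ∧
        D'.carrier ∩ Metric.ball (D.pt 1) ε = D.carrier ∩ Metric.ball (D.pt 1) ε) →
      E'.carrier ⊆ E.carrier → E'.pt 0 = E.pt 0 → E'.pt 1 = E.pt 1 →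
      (∃ ε : ℝ, 0 < ε ∧ E'.carrier ∩ Metric.ball (E.pt 0) ε = E.carrier ∩ Metric.ball (E.pt 0) ε ∧
        E'.carrier ∩ Metric.ball (E.pt 1) ε = E.carrier ∩ Metric.ball (E.pt 1) ε) →
      g.HasBoundaryValue (D.pt 0) (E.pt 0) → g.HasBoundaryValue (D.pt 1) (E.pt 1) →
      g '' D'.carrier = E'.carrier →
      ∀ r₁ r₂ : ENNReal,
        Tendsto (fun δ => ((SAW.law D.carrier δ (a δ) (b δ)).map (fun γ => γ.curve))
            (CurveClass.rangeSubset (closure D'.carrier))) (𝓝[>] 0) (𝓝 r₁) →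
        Tendsto (fun δ => ((SAW.law E.carrier δ (c δ) (d δ)).map (fun γ => γ.curve))
            (CurveClass.rangeSubset (closure E'.carrier))) (𝓝[>] 0) (𝓝 r₂) → r₁ = r₂ := by
  intro D D' E E' a b c d g hab hcd hsub h0 h1 hball hEsub hE0 hE1 hEball hg0 hg1 hgD' r₁ r₂ hr₁ hr₂
  obtain ⟨r, hrD, hrE⟩ := h D D' E E' a b c d g hab hcd hsub h0 h1 hball hEsub hE0 hE1 hEball hg0 hg1
    hgD'
  exact (tendsto_nhds_unique hr₁ hrD).trans (tendsto_nhds_unique hrE hr₂)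

/-- **Existence + invariance ⇒ `ConformalAvoidance`**: from the existence of the full-filter avoidance
limits for every hull pair and endpoint approximation (`AvoidanceCocycleLimit`) and the conformal
invariance of the limit values (`ConformallyInvariantLimits`, literal), the crux follows: the two
limits `r₁`, `r₂` exist and coincide, and `r := r₁` serves both convergences. [folklore] -/
theorem conformalAvoidance_of_exists_of_invariant (h₁ : AvoidanceCocycleLimit)
    (h₂ : ∀ (D D' E E' : DobrushinDomain) (a b c d : ℝ → Site 2)
      (g : ConformalEquiv D.carrier E.carrier),
      SAW.IsEndpointApprox D a b → SAW.IsEndpointApprox E c d →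
      D'.carrier ⊆ D.carrier → D'.pt 0 = D.pt 0 → D'.pt 1 = D.pt 1 →
      (∃ ε : ℝ, 0 < ε ∧ D'.carrier ∩ Metric.ball (D.pt 0) ε = D.carrier ∩ Metric.ball (D.pt 0) ε ∧
        D'.carrier ∩ Metric.ball (D.pt 1) ε = D.carrier ∩ Metric.ball (D.pt 1) ε) →
      E'.carrier ⊆ E.carrier → E'.pt 0 = E.pt 0 → E'.pt 1 = E.pt 1 →
      (∃ ε : ℝ, 0 < ε ∧ E'.carrier ∩ Metric.ball (E.pt 0) ε = E.carrier ∩ Metric.ball (E.pt 0) ε ∧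
        E'.carrier ∩ Metric.ball (E.pt 1) ε = E.carrier ∩ Metric.ball (E.pt 1) ε) →
      g.HasBoundaryValue (D.pt 0) (E.pt 0) → g.HasBoundaryValue (D.pt 1) (E.pt 1) →
      g '' D'.carrier = E'.carrier →
      ∀ r₁ r₂ : ENNReal,
        Tendsto (fun δ => ((SAW.law D.carrier δ (a δ) (b δ)).map (fun γ => γ.curve))
            (CurveClass.rangeSubset (closure D'.carrier))) (𝓝[>] 0) (𝓝 r₁) →
        Tendsto (fun δ => ((SAW.law E.carrier δ (c δ) (d δ)).map (fun γ => γ.curve))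
            (CurveClass.rangeSubset (closure E'.carrier))) (𝓝[>] 0) (𝓝 r₂) → r₁ = r₂) :
    ConformalAvoidance := by
  intro D D' E E' a b c d g hab hcd hsub h0 h1 hball hEsub hE0 hE1 hEball hg0 hg1 hgD'
  obtain ⟨r₁, hr₁⟩ := h₁ D D' a b hab hsub h0 h1 hball
  obtain ⟨r₂, hr₂⟩ := h₁ E E' c d hcd hEsub hE0 hE1 hEball
  have heq : r₁ = r₂ :=
    h₂ D D' E E' a b c d g hab hcd hsub h0 h1 hball hEsub hE0 hE1 hEball hg0 hg1 hgD' r₁ r₂ hr₁ hr₂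
  refine ⟨r₁, hr₁, ?_⟩
  rw [heq]
  exact hr₂

/-- **`ConformalAvoidance ↔ AvoidanceCocycleLimit ∧ ConformallyInvariantLimits`**: the crux is exactly
the existence of the full-filter avoidance limits (the sibling crux stmt-CriticalPhenomena-1369) together
with the conformal invariance of their values — the top-level split of the birth skeleton loses
nothing. [folklore] -/
theorem conformalAvoidance_iff :
    ConformalAvoidance ↔
      (AvoidanceCocycleLimit ∧
        ∀ (D D' E E' : DobrushinDomain) (a b c d : ℝ → Site 2)
          (g : ConformalEquiv D.carrier E.carrier),
          SAW.IsEndpointApprox D a b → SAW.IsEndpointApprox E c d →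
          D'.carrier ⊆ D.carrier → D'.pt 0 = D.pt 0 → D'.pt 1 = D.pt 1 →
          (∃ ε : ℝ, 0 < ε ∧ D'.carrier ∩ Metric.ball (D.pt 0) ε = D.carrier ∩ Metric.ball (D.pt 0) ε ∧
            D'.carrier ∩ Metric.ball (D.pt 1) ε = D.carrier ∩ Metric.ball (D.pt 1) ε) →
          E'.carrier ⊆ E.carrier → E'.pt 0 = E.pt 0 → E'.pt 1 = E.pt 1 →
          (∃ ε : ℝ, 0 < ε ∧ E'.carrier ∩ Metric.ball (E.pt 0) ε = E.carrier ∩ Metric.ball (E.pt 0) ε ∧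
            E'.carrier ∩ Metric.ball (E.pt 1) ε = E.carrier ∩ Metric.ball (E.pt 1) ε) →
          g.HasBoundaryValue (D.pt 0) (E.pt 0) → g.HasBoundaryValue (D.pt 1) (E.pt 1) →
          g '' D'.carrier = E'.carrier →
          ∀ r₁ r₂ : ENNReal,
            Tendsto (fun δ => ((SAW.law D.carrier δ (a δ) (b δ)).map (fun γ => γ.curve))
                (CurveClass.rangeSubset (closure D'.carrier))) (𝓝[>] 0) (𝓝 r₁) →
            Tendsto (fun δ => ((SAW.law E.carrier δ (c δ) (d δ)).map (fun γ => γ.curve))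
                (CurveClass.rangeSubset (closure E'.carrier))) (𝓝[>] 0) (𝓝 r₂) → r₁ = r₂) :=
  ⟨fun h => ⟨avoidanceCocycleLimit_of_conformalAvoidance h,
      conformallyInvariantLimits_of_conformalAvoidance h⟩,
    fun h => conformalAvoidance_of_exists_of_invariant h.1 h.2⟩

end Summit.CriticalPhenomena.SAWScalingLimit.Theorems.ConformalAvoidance

end
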